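import Summits.BirchSwinnertonDyer.BirchSwinnertonDyer.Theorems.KatoDescentPotSupersingularWildUpperOptimalSharpRoadJ08S2b
import Summits.BirchSwinnertonDyer.BirchSwinnertonDyer.Theorems.KatoDescentPotSupersingularWildUpperHeegnerSharpRoad
import Summits.BirchSwinnertonDyer.BirchSwinnertonDyer.Theorems.KimAtThreeKolyvaginIsogenyTransport
import Summits.BirchSwinnertonDyer.BirchSwinnertonDyer.Theorems.SmallImageMuTransferMuTransferStubCm
import Summits.BirchSwinnertonDyer.Rank1Residual.X12.InertCoreEveryCurve
import Summits.BirchSwinnertonDyer.Rank1Residual.O6.X3WildOfKMCTorsionFreeMember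
import Literature.NumberTheory.EllipticCurves.IsogenyQuadraticTwistProofs
import HarnessLib

/-!
# Route `KatoDescentPotSupersingular` (rung K9, wild `3`, cell `bsd-potss`) — the BODY of the U₀-ns node `WildUpperNonsurjTower`
# (item 19189) over the TWO-SPLIT Heegner readings WITHOUT THE L₀ INPUT and with the rank-one residual WEAKENED TO ITS LOWER HALF
# (sibling of `…WildUpperOptimalSharpNodesJ08S2b`, p564462; seat `bsd-potss-k9-c4` g12; route-free; nothing booked, no item closed,
# BSD is not proved by any of this)

WHY A SIBLING FILE. `…WildUpperOptimalSharpNodesJ08S2b` (k9-c4 g11) derives the U₀-ns node from the two Jetchev readings in their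
«`2` splits in `K`» form (`hJ`, `hJp` — theorems modulo four named facts, p564108 / p564034), the Heegner-road published inputs,
Cassels, Coates–Sujatha's (A) on the residue rows, and the BODIES of three further K9 items: L₀ `WildLowerHalfRankZero` (19195, an
OPEN PROBLEM), the residual `WildRankOne` (19200, an OPEN PROBLEM) and the cite-level inputs. Two of these uses are idle:
* `h₂` (L₀) is used at exactly ONE place — `#Ш_an(E) ∈ ℚ` ⇒ (Cassels) `#Ш_an(E₀) ∈ ℚ` ⇒ `L(E₀,1)/Ω(E₀) ∈ ℚ` at the optimal member.
  That rationality is a TREE THEOREM with no BSD input (k8t-c4 g13's observation for the KT twin, p571709): Manin–Drinfeld for the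
  newform is PROVED (`IsNewformOf.entireLFunction_one_eq : L(E,1) = [0]⁺_f · Ω⁺_f`, `[0]⁺_f ∈ ℚ`) and
  `ModularParametrizationData.exists_rat_mul_realPeriodRat_eq_plusPeriod : ϖ · Ω(E) = Ω⁺_f` (`ϖ ∈ ℚ_{>0}`) is PROVED, so at the
  optimal datum `D₀` one has `L(E₀,1)/Ω(E₀) = [0]⁺ · ϖ ∈ ℚ` (`exists_ratio_rat_of_modularParametrizationData`, §1).
* `hR` (the residual, `MissingPPartAt` = BOTH halves of BSD₃ at the rank-one O6 rows) is used at exactly ONE place and only through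
  its FIRST projection: the LOWER half `ord₃ #Ш_an(E^K) ≤ ord₃ #Ш(E^K)` at the (rank-one, globally minimal) Heegner twist, which is
  what isolates `ord₃ #Ш(E)` in Kolyvagin's bound for `#Ш(E/K)`. The UPPER half at the twist is never used.
This file is p564462's theorem with `h₂` REMOVED (Manin–Drinfeld in its place) and `hR` REPLACED by the displayed lower-half schema
`hRlow : ∀ W, r_an(W) = 1 → ClassO6 W 3 → MissingLowerBoundAt W 3` (§2); §3 re-derives the `MissingPPartAt` form (the body of
`WildRankOne` verbatim) as a one-line corollary, so glue closers keyed on the route decl keep working. Consequence for the route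
(planner's (36c) package / any re-key of glue 20173): the U₀-ns node — and with it U₀ `WildUpperDefectRankZero` (item 19197) — does
NOT depend on L₀, and depends on the residual only through its lower half (a weaker residual node `WildRankOneLower` would suffice).
Conditional throughout (schemas `hJ`, `hJp`, (A) on the residue rows `hCS`, `hRlow`, named published inputs); nothing asserted;
NO item closed.

References: [Manin1972] Cor. 3.6; [EdixhovenManin1991] §1; [MazurTateTeitelbaum1986Invent] §I.8 (8.6); [Jetchev2008] Thm. 1.4,
Cor. 1.5 (p. 3), Rem. 6.2 (p. 15); [MatarNekovar2019] Thm. 0.3, §0.11; [MilneADT2006] Thm. I.7.3; [Kato2004Asterisque] Thm. 14.5 (3);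
[CoatesSujatha2005] Conj. A; [BurungaleFlach2024] Thm. 1.1; [CremonaAlgorithms1997] §3.9; [GrossZagier1986] V (2.2); [Kolyvagin1990].
-/

set_option autoImplicit false
-- the Theorems directory repeats the summit name (sibling precedent `KatoDescentPotSupersingularAssembly.lean`)
set_option linter.dupNamespace false

noncomputable section

open scoped Classical NumberField

namespace Summit.BirchSwinnertonDyer.BirchSwinnertonDyer.Theorems.WildUpperOptimalSharpNodesJ08S2bMD

open WeierstrassCurve IsDedekindDomain IsDedekindDomain.HeightOneSpectrum NumberField
  Rat.HeightOneSpectrum Literature.NumberTheory.EllipticCurves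
  Literature.NumberTheory.EllipticCurves.ModularForms
  Literature.NumberTheory.DiophantineGeometry
  Literature.NumberTheory.EllipticCurves.Rank1Residual
  Literature.NumberTheory.EllipticCurves.Rank1Residual.Typed
  Literature.NumberTheory.Automorphic Literature.NumberTheory.EllipticCurves.KrizLi2019
  Literature.NumberTheory.QuadraticFields
  Summit.BirchSwinnertonDyer.Rank1Residual
  Summit.BirchSwinnertonDyer.Rank1Residual.Additive
  Summit.BirchSwinnertonDyer.Rank1Residual.O6
  Summit.BirchSwinnertonDyer.BirchSwinnertonDyer.Theorems
  Summit.BirchSwinnertonDyer.BirchSwinnertonDyer.Theorems.WildUpperOptimalSharpRoadJ08S2b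

/-! ### §1 Private re-homings (the fine-Selmer port; rationality) -/

/-- **Rank-`0` upper bound with the torsion term from the fine-Selmer reading** (private re-homing of g0's lemma,
as in the K9 sharp road): at an odd additive potentially good `p` with `E[p]` irreducible and `Y(E/ℚ^cyc)` finitely
generated over `ℤ_p` (`hA`), `#Ш_an = q` and `ord_p #Ш ≤ ord_p q − 2 ord_p #E(ℚ)_tors`.
[cite: Kato2004Asterisque, Thm. 14.5 (3) (p. 236), Thm. 12.5 (3) (p. 222), 14.14 (p. 243), Prop. 14.16 (2) (p. 244)]
[cite: Lim2017FineSelmer, §3] [cite: Miller2011LMS, Def. 1.1] -/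
private theorem padicValNat_shaOrder_le_of_katoFineSelmer_rankZero
    (hKatoA :
      Kato2004.rankZero_padicValNat_sha_add_padicValNat_tamagawa_le_of_additive_potGood_of_irreducible_of_fineSelmerDual_fg)
    (hGZK : rank_eq_analyticRank_of_analyticRank_le_one) (hmod : hasEntireLFunction_rat)
    (W : WeierstrassCurve ℚ) [W.IsElliptic] [W.IsGloballyMinimal] (p : ℕ) [Fact p.Prime]
    (hp : p ≠ 2) (hgood : ¬ W.HasGoodReductionAtPrime p) (hmult : ¬ W.HasMultiplicativeReductionAtPrime p)
    (hpot : 0 ≤ padicValRat p W.j) (hirr : W.HasIrreducibleModPGaloisRep p)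
    (hA : ∀ (κ : ZpExtension ℚ p), κ.IsCyclotomic →
      ∃ (γ : Field.absoluteGaloisGroup ℚ) (D : W.FineSelmerDualData κ γ),
        Module.Finite ℤ_[p] (RestrictScalars ℤ_[p] (IwasawaAlgebra p) D.X))
    (hr : W.analyticRank = 0) :
    ∃ q : ℚ, shaAn W = (q : ℂ) ∧
      (padicValNat p W.shaOrder : ℤ) ≤ padicValRat p q - 2 * padicValNat p W.torsionOrder := by
  have hL : W.entireLFunction 1 ≠ 0 := (W.analyticRank_eq_zero_iff_holds (hmod W)).mp hr
  obtain ⟨hmw, hfin⟩ := hGZK W (by rw [hr]; exact zero_le_one)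
  haveI : Finite W.sha := hfin
  have hmw0 : W.mordellWeilRank = 0 := by rw [hmw, hr]
  obtain ⟨q₀, hq₀, hle⟩ := hKatoA W p hp hgood hmult hpot hirr hA hL hfin
  have hΩpos : 0 < W.realPeriodRat := W.realPeriodRat_pos_holds
  have hΩ : (W.realPeriodRat : ℂ) ≠ 0 := by exact_mod_cast hΩpos.ne'
  have hc0 : 0 < W.tamagawaProduct := W.tamagawaProduct_pos_holds
  have ht0 : 0 < W.torsionOrder := W.torsionOrder_pos_holds
  have hq₀0 : q₀ ≠ 0 := by
    rintro rfl
    rw [Rat.cast_zero, div_eq_zero_iff] at hq₀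
    exact hq₀.elim hL hΩ
  refine ⟨q₀ * (W.torsionOrder : ℚ) ^ 2 / (W.tamagawaProduct : ℚ), ?_, ?_⟩
  · have hLq : W.entireLFunction 1 = (q₀ : ℂ) * (W.realPeriodRat : ℂ) := by
      rw [← hq₀, div_mul_cancel₀ _ hΩ]
    rw [shaAn_def, W.leadingLCoeff_eq_of_analyticRank_eq_zero hr,
      W.regulator_eq_one_of_rank_zero hmw0, hLq]
    push_cast
    field_simp
  · have ht : (W.torsionOrder : ℚ) ≠ 0 := by exact_mod_cast ht0.ne'
    have hcq : (W.tamagawaProduct : ℚ) ≠ 0 := by exact_mod_cast hc0.ne'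
    have hsha : padicValNat p (Nat.card (AddCommGroup.primaryComponent W.sha p)) =
        padicValNat p W.shaOrder := by
      unfold WeierstrassCurve.shaOrder
      exact padicValNat_card_addPrimaryComponent p
    have hv : padicValRat p (q₀ * (W.torsionOrder : ℚ) ^ 2 / (W.tamagawaProduct : ℚ)) =
        padicValRat p q₀ + 2 * (padicValNat p W.torsionOrder : ℤ) -
          (padicValNat p W.tamagawaProduct : ℤ) := by
      rw [padicValRat.div (mul_ne_zero hq₀0 (pow_ne_zero 2 ht)) hcq,
        padicValRat.mul hq₀0 (pow_ne_zero 2 ht), pow_two, padicValRat.mul ht ht,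
        padicValRat.of_nat, padicValRat.of_nat]
      ring
    rw [hv, ← hsha]
    linarith

/-- **`L(E,1)/Ω(E) ∈ ℚ` from a modular parametrisation datum, by Manin–Drinfeld** (private re-homing of k8t-c4 g13's lemma of
p571709; tree theorems only): `L(E,1) = [0]⁺_f · Ω⁺_f` (`IsNewformOf.entireLFunction_one_eq`, `[0]⁺_f = ratPlusSymbol f 0 ∈ ℚ` by the
proved Manin–Drinfeld theorem) and `ϖ · Ω(E) = Ω⁺_f` with `ϖ ∈ ℚ_{>0}` (`ModularParametrizationData.exists_rat_mul_realPeriodRat_eq_plusPeriod`)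
give `L(E,1)/Ω(E) = [0]⁺_f · ϖ ∈ ℚ`. This REPLACES the only use the J08 roads make of the L₀ node `WildLowerHalfRankZero`
(`#Ш_an(E) ∈ ℚ`, moved to the optimal member by Cassels). [cite: Manin1972, Cor. 3.6] [cite: EdixhovenManin1991, §1]
[cite: MazurTateTeitelbaum1986Invent, §I.8 (8.6)] -/
private theorem exists_ratio_rat_of_modularParametrizationData (W : WeierstrassCurve ℚ) [W.IsElliptic]
    [W.IsGloballyMinimal] {N : ℕ} [NeZero N] (D : ModularParametrizationData W N) :
    ∃ q0 : ℚ, W.entireLFunction 1 / (W.realPeriodRat : ℂ) = (q0 : ℂ) := by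
  obtain ⟨ϖ, -, hϖ, hΩ⟩ := D.exists_rat_mul_realPeriodRat_eq_plusPeriod
  refine ⟨ratPlusSymbol D.f 0 * ϖ, ?_⟩
  have hΩ0 : (W.realPeriodRat : ℂ) ≠ 0 := by exact_mod_cast hΩ.ne'
  rw [div_eq_iff hΩ0, D.isNewformOf.entireLFunction_one_eq, ← hϖ]
  push_cast
  ring

/-! ### §2 The BODY of the U₀-ns node `WildUpperNonsurjTower` through the optimal member — no L₀, lower-half residual only -/

/-- **The BODY of the K9 U₀-ns node `WildUpperNonsurjTower` (item 19189) WITHOUT L₀ and with the residual WEAKENED to its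
lower half** — from: the two JETCHEV READINGS in two-split form `hJ` (`q ≠ 3`) and `hJp` (`q = 3`) (displayed schemas in the
vocabulary of `Jetchev2008.cor15_padicValNat_card_primaryComponent_sha_le` with the extra binder `SatisfiesHeegnerHypothesis 2 K`;
theorems modulo four named facts by p564108 / p564034, NOT asserted here), the Heegner-road published facts and CASSELS' isogeny
invariance, COATES–SUJATHA'S (A) ONLY ON THE RESIDUE ROWS (`hCS`), the LOWER HALF `ord₃ #Ш_an ≤ ord₃ #Ш` at the rank-one O6 rows
(`hRlow`, the only projection of the residual `WildRankOne` the road consumes — at the globally minimal Heegner twists), and the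
BODIES of the cite-level K9 items `KatoTamagawaExactInputs`, `PublishedInputsFineSelmerCM`. The rationality of `L(E₀,1)/Ω(E₀)` at the
optimal member — formerly read off the L₀ body — is Manin–Drinfeld (`exists_ratio_rat_of_modularParametrizationData`). Rows: CM →
Burungale–Flach; residue → the fine-Selmer port + (A) at `W`; otherwise the two-split road p563930 at the OPTIMAL member `W₀`
(transports along the isogeny; the twists' lower halves carried from `W`'s twists by Cassels; the result carried back by Cassels).
Conditional; nothing asserted; NO item is closed; BSD is not proved by any of this.
[cite: Manin1972, Cor. 3.6] [cite: Jetchev2008, Hypothesis (*), Thm. 1.4, Cor. 1.5 (p. 3), Lemma 4.3, 4.5 (p. 9), Rem. 6.2 (p. 15)]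
[cite: MatarNekovar2019, Thm. 0.3 (p. 456), §0.11 (p. 457)] [cite: MilneADT2006, Thm. I.7.3 and Remark I.7.4]
[cite: Kato2004Asterisque, Thm. 14.5 (3) (p. 236)] [cite: CoatesSujatha2005, Conjecture A]
[cite: BurungaleFlach2024, Thm. 1.1 and Cor. 2 (p. 4)] [cite: CremonaAlgorithms1997, §3.9 (p. 87)] -/
theorem wildUpperNonsurjTower_of_jetchev08TwoSplit_of_cruxAResidue_of_rankOneLower_of_maninDrinfeld
    (hJ : ∀ (N : ℕ) [NeZero N] (W : WeierstrassCurve ℚ) [W.IsElliptic] [W.IsGloballyMinimal]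
      (K : Type) [Field K] [NumberField K],
      IsImaginaryQuadratic K → NumberField.discr K ≠ -3 → NumberField.discr K ≠ -4 →
      SatisfiesHeegnerHypothesis N K → SatisfiesHeegnerHypothesis 2 K →
      ∀ (p : ℕ) [Fact p.Prime], p ≠ 2 → W.analyticRank = 0 → Addv W p → 0 ≤ padicValRat p W.j →
      ¬ W.HasCM → W.HasIrreducibleModPGaloisRep p →
      ¬ (∀ n : ℕ, W.HasSurjectiveModNGaloisRep (p ^ n : ℕ)) →
      (∃ Dt : ModularParametrizationData W N,
        (∀ z ∈ Dt.L.lattice, ∃ w ∈ periodLattice Dt.f, z = (Dt.c : ℂ) * w) ∧ ¬ (p : ℤ) ∣ Dt.c) →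
      ¬ p ∣ (W.baseChange ℚ_[p]).localTamagawaNumber ℤ_[p] →
      (∀ (q' : ℕ) [Fact q'.Prime], q' ∣ N →
        p ∣ (W.baseChange ℚ_[q']).localTamagawaNumber ℤ_[q'] → ¬ q' ^ 2 ∣ N) →
      ∀ {P : (W.baseChange K).toAffine.Point}, IsHeegnerPoint N W K P → ¬ IsOfFinAddOrder P →
      ∀ (q : ℕ) [Fact q.Prime], q ∣ N → ¬ q ^ 2 ∣ N → q ≠ p →
      padicValNat p (Nat.card (AddCommGroup.primaryComponent (W.baseChange K).sha p)) +
          2 * padicValNat p ((W.baseChange ℚ_[q]).localTamagawaNumber ℤ_[q]) ≤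
        2 * padicValNat p (AddSubgroup.zmultiples P).index)
    (hJp : ∀ (N : ℕ) [NeZero N] (W : WeierstrassCurve ℚ) [W.IsElliptic] [W.IsGloballyMinimal]
      (K : Type) [Field K] [NumberField K],
      IsImaginaryQuadratic K → NumberField.discr K ≠ -3 → SatisfiesHeegnerHypothesis N K →
      SatisfiesHeegnerHypothesis 2 K →
      ∀ (p : ℕ) [Fact p.Prime], p ≠ 2 → W.analyticRank = 0 → Addv W p → 0 ≤ padicValRat p W.j →
      ¬ W.HasCM → W.HasIrreducibleModPGaloisRep p → ¬ (∀ n : ℕ, W.HasSurjectiveModNGaloisRep (p ^ n : ℕ)) →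
      (∃ Dt : ModularParametrizationData W N,
        (∀ z ∈ Dt.L.lattice, ∃ w ∈ periodLattice Dt.f, z = (Dt.c : ℂ) * w) ∧ ¬ (p : ℤ) ∣ Dt.c) →
      ∀ {P : (W.baseChange K).toAffine.Point}, IsHeegnerPoint N W K P → ¬ IsOfFinAddOrder P →
      p ∣ N →
      padicValNat p (Nat.card (AddCommGroup.primaryComponent (W.baseChange K).sha p)) +
          2 * padicValNat p ((W.baseChange ℚ_[p]).localTamagawaNumber ℤ_[p]) ≤
        2 * padicValNat p (AddSubgroup.zmultiples P).index)
    (hGZ : ∀ (N : ℕ) [NeZero N] (W : WeierstrassCurve ℚ) (K : Type) [Field K] [NumberField K],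
      gross_zagier N W K)
    (hKo : ∀ (N : ℕ) [NeZero N] (W : WeierstrassCurve ℚ) (K : Type) [Field K] [NumberField K],
      kolyvagin N W K)
    (hMN : ∀ (N : ℕ) [NeZero N] (W : WeierstrassCurve ℚ) (K : Type) [Field K] [NumberField K],
      MatarNekovar2019.thm03_padicValNat_card_sha_le_of_irreducible N W K)
    (hnf : exists_isNewformOf) (hBFH : bumpFriedbergHoffstein_exists_heegnerField_split_twist_simpleZero)
    (hCassels : bsdRHS_eq_of_isIsogenous)
    (hCS : ∀ (W : WeierstrassCurve ℚ) [W.IsElliptic] [W.IsGloballyMinimal] [Fact (3 : ℕ).Prime],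
      W.analyticRank = 0 → ClassO6 W 3 → W.HasIrreducibleModPGaloisRep 3 →
      ¬ (∀ n : ℕ, W.HasSurjectiveModNGaloisRep (3 ^ n : ℕ)) → ¬ W.HasCM →
      (∃ (W₀ : WeierstrassCurve ℚ) (_ : W₀.IsElliptic) (_ : W₀.IsGloballyMinimal)
          (_ : NeZero (W₀.conductorNorm ℤ)) (D₀ : ModularParametrizationData W₀ (W₀.conductorNorm ℤ)),
        IsIsogenous W W₀ ∧ (∀ z ∈ D₀.L.lattice, ∃ w ∈ periodLattice D₀.f, z = (D₀.c : ℂ) * w) ∧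
        ((3 : ℤ) ∣ D₀.c ∨ (3 ∣ W₀.tamagawaProduct ∧
          ¬ ∃ (q : ℕ) (_ : Fact q.Prime), q ∣ W₀.conductorNorm ℤ ∧
            (q ≠ 3 → ¬ q ^ 2 ∣ W₀.conductorNorm ℤ ∧ ¬ 3 ∣ (W₀.baseChange ℚ_[3]).localTamagawaNumber ℤ_[3]) ∧
            padicValNat 3 W₀.tamagawaProduct ≤
              padicValNat 3 ((W₀.baseChange ℚ_[q]).localTamagawaNumber ℤ_[q])))) →
      ∀ (κ : ZpExtension ℚ 3), κ.IsCyclotomic →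
        ∃ (γ : Field.absoluteGaloisGroup ℚ) (Df : W.FineSelmerDualData κ γ),
          Module.Finite ℤ_[3] (RestrictScalars ℤ_[3] (IwasawaAlgebra 3) Df.X))
    (hRlow : ∀ (W : WeierstrassCurve ℚ) [W.IsElliptic] [W.IsGloballyMinimal] [Fact (3 : ℕ).Prime],
      W.analyticRank = 1 → ClassO6 W 3 → MissingLowerBoundAt W 3)
    (hK : Kato2004.rankZero_padicValNat_sha_add_padicValNat_tamagawa_le_of_additive_potGood_of_imageContainsSL2 ∧
      rank_eq_analyticRank_of_analyticRank_le_one ∧ WeierstrassCurve.hasEntireLFunction_rat)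
    (hF : Kato2004.rankZero_padicValNat_sha_add_padicValNat_tamagawa_le_of_additive_potGood_of_irreducible_of_fineSelmerDual_fg ∧
      bsdTriple_of_hasCM_of_L_one_ne_zero) :
    ∀ (W : WeierstrassCurve ℚ) [W.IsElliptic] [W.IsGloballyMinimal] [Fact (3 : ℕ).Prime],
      W.analyticRank = 0 → ClassO6 W 3 → W.HasIrreducibleModPGaloisRep 3 →
      ¬ (∀ n : ℕ, W.HasSurjectiveModNGaloisRep (3 ^ n : ℕ)) → MissingUpperBoundAt W 3 := by
  obtain ⟨-, hGZK, hmod⟩ := hK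
  intro W _ _ _ hr hO hI hnsT
  haveI : NeZero (W.conductorNorm ℤ) := ⟨(conductorNorm_pos_holds W).ne'⟩
  have hp2 : (3 : ℕ) ≠ 2 := hO.1
  have hadd : Addv W 3 := hO.2.1
  have hj : 0 ≤ padicValRat 3 W.j := hO.padicValRat_j_nonneg
  -- CM rows: Burungale–Flach
  by_cases hcm : W.HasCM
  · haveI : Finite W.sha := (hGZK W (by rw [hr]; exact zero_le_one)).2
    exact (lower_and_upper_of_missingPPartAt W 3 (missingPPartAt_of_bsdp W 3
      (Summit.BirchSwinnertonDyer.Rank1Residual.bsdp_cm_rankZero hF.2 hmod hcm hr))).2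
  -- the optimal member of the class and its lattice-optimal datum (Modularity)
  obtain ⟨W₀, hE₀, hM₀, hNZ₀, D₀, hiso, hN, hopt⟩ := X12.exists_isIsogenous_optimal hnf W
  -- the residue rows: the fine-Selmer port + (A) at `W`
  by_cases hres : (3 : ℤ) ∣ D₀.c ∨ (3 ∣ W₀.tamagawaProduct ∧
      ¬ ∃ (q : ℕ) (_ : Fact q.Prime), q ∣ W₀.conductorNorm ℤ ∧
        (q ≠ 3 → ¬ q ^ 2 ∣ W₀.conductorNorm ℤ ∧ ¬ 3 ∣ (W₀.baseChange ℚ_[3]).localTamagawaNumber ℤ_[3]) ∧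
        padicValNat 3 W₀.tamagawaProduct ≤ padicValNat 3 ((W₀.baseChange ℚ_[q]).localTamagawaNumber ℤ_[q]))
  · obtain ⟨q, hq, hle⟩ := padicValNat_shaOrder_le_of_katoFineSelmer_rankZero hF.1 hGZK hmod W 3 hp2 hadd.1
      hadd.2 hj hI (hCS W hr hO hI hnsT hcm ⟨W₀, hE₀, hM₀, hNZ₀, D₀, hiso, hopt, hres⟩) hr
    refine ⟨q, hq, ?_⟩
    rw [padicValNat_torsionOrder_eq_zero_of_irreducible W 3 hI] at hle
    simpa using hle
  have hc₀ : ¬ (3 : ℤ) ∣ D₀.c := fun h ↦ hres (Or.inl h)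
  have hsingle₀ : 3 ∣ W₀.tamagawaProduct → ∃ (q : ℕ) (_ : Fact q.Prime), q ∣ W₀.conductorNorm ℤ ∧
      (q ≠ 3 → ¬ q ^ 2 ∣ W₀.conductorNorm ℤ ∧ ¬ 3 ∣ (W₀.baseChange ℚ_[3]).localTamagawaNumber ℤ_[3]) ∧
      padicValNat 3 W₀.tamagawaProduct ≤ padicValNat 3 ((W₀.baseChange ℚ_[q]).localTamagawaNumber ℤ_[q]) := by
    intro ht
    by_contra hne
    exact hres (Or.inr ⟨ht, hne⟩)
  -- transports along `W ∼ W₀`: analytic rank, additivity with integral `j`, CM, `E[3]`, the `3`-adic tower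
  have hr₀ : W₀.analyticRank = 0 := by rw [← analyticRank_eq_of_isIsogenous' hiso]; exact hr
  obtain ⟨hadd₀, hj₀⟩ := Addv.of_isIsogenous_of_padicValRat_j_nonneg (p := 3) hadd hj hiso
  obtain ⟨e, he⟩ :=
    Summit.BirchSwinnertonDyer.BirchSwinnertonDyer.Rank1Residual.exists_torsionIso_of_isIsogenous_of_irreducible
      (p := 3) hI hiso
  have hI₀ : W₀.HasIrreducibleModPGaloisRep 3 :=
    GreenbergVatsal2000.hasIrreducibleModPGaloisRep_of_torsionIso e he hI
  have hns₀ : ¬ (∀ n : ℕ, W₀.HasSurjectiveModNGaloisRep (3 ^ n : ℕ)) := fun h ↦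
    hnsT (KimAtThreeKolyvaginIsogenyTransport.towerSurjective_of_isIsogenous hiso.symm_of_charZero h)
  have hcm₀ : ¬ W₀.HasCM := fun h ↦ hcm ((X12.hasCM_iff_of_isIsogenous hiso).mpr h)
  -- rationality of `L(E₀,1)/Ω(E₀)`: Manin–Drinfeld at the optimal datum `D₀` (tree theorem; no L₀ input)
  have hrat₀ := exists_ratio_rat_of_modularParametrizationData W₀ D₀
  -- the twists' lower halves: `hRlow` at the minimal model of `E^{(d_K)}` (a rank-one O6 row), moved by Cassels
  have hlow₀ : ∀ (K : Type) [Field K] [NumberField K], IsImaginaryQuadratic K →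
      SatisfiesHeegnerHypothesis (W₀.conductorNorm ℤ) K → Odd (NumberField.discr K) →
      ∀ (Wd : WeierstrassCurve ℚ) [Wd.IsElliptic] [Wd.IsGloballyMinimal] (Cd : VariableChange ℚ),
        Cd • W₀.quadraticTwist (NumberField.discr K : ℚ) = Wd → Wd.analyticRank = 1 →
        MissingLowerBoundAt Wd 3 := by
    intro K _ _ hKq hHN₀ hodd Wd₀ _ _ Cd₀ hWd₀ hrd₀
    have hHN : SatisfiesHeegnerHypothesis (W.conductorNorm ℤ) K := by rw [← hN]; exact hHN₀
    have hD0 : (NumberField.discr K : ℚ) ≠ 0 := by exact_mod_cast NumberField.discr_ne_zero K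
    haveI : (W.quadraticTwist (NumberField.discr K : ℚ)).IsElliptic := W.isElliptic_quadraticTwist hD0
    haveI : (W₀.quadraticTwist (NumberField.discr K : ℚ)).IsElliptic := W₀.isElliptic_quadraticTwist hD0
    obtain ⟨Cd, hCd⟩ := hasGlobalMinimalModel_rat_holds (W.quadraticTwist (NumberField.discr K : ℚ))
    haveI : (Cd • W.quadraticTwist (NumberField.discr K : ℚ)).IsGloballyMinimal := hCd
    obtain ⟨hOd, -⟩ := classO6_twist_of_heegner W hO K hKq hHN hodd
      (Cd • W.quadraticTwist (NumberField.discr K : ℚ)) Cd rfl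
    haveI : NeZero (2 : ℚ) := ⟨two_ne_zero⟩
    have hisoT : IsIsogenous (Cd • W.quadraticTwist (NumberField.discr K : ℚ)) Wd₀ := by
      rw [← hWd₀]
      exact IsIsogenous.trans' (IsIsogenous.trans' (isIsogenous_of_smul _ Cd) (hiso.quadraticTwist hD0))
        (isIsogenous_smul _ Cd₀)
    have hrd : (Cd • W.quadraticTwist (NumberField.discr K : ℚ)).analyticRank = 1 := by
      rw [analyticRank_eq_of_isIsogenous' hisoT]; exact hrd₀
    have hlowd : MissingLowerBoundAt (Cd • W.quadraticTwist (NumberField.discr K : ℚ)) 3 := hRlow _ hrd hOd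
    have hfind : Finite (Cd • W.quadraticTwist (NumberField.discr K : ℚ)).sha :=
      (hGZK _ (by rw [hrd])).2
    have hleadd : (Cd • W.quadraticTwist (NumberField.discr K : ℚ)).leadingLCoeff ≠ 0 :=
      (Cd • W.quadraticTwist (NumberField.discr K : ℚ)).leadingLCoeff_ne_zero_holds (hmod _)
    exact X12.missingLowerBoundAt_of_isIsogenous hCassels hisoT.symm_of_charZero hfind hleadd hlowd
  -- the upper half at the optimal member, then back to `W` by Cassels
  have hup₀ : MissingUpperBoundAt W₀ 3 :=
    WildUpperOptimalSharpRoadJ08S2b.missingUpperBoundAt_rankZero_of_optimalDatum_of_jetchev08TwoSplit_of_boundAtPTwoSplit hGZ hKo hMN hGZK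
      hmod hnf hBFH hJ hJp W₀ 3
      hr₀ hp2 hadd₀ hj₀ hcm₀ hI₀ hns₀ D₀ hopt hc₀ hsingle₀ hrat₀ hlow₀
  have hfin₀ : Finite W₀.sha := (hGZK W₀ (by rw [hr₀]; exact zero_le_one)).2
  have hlead₀ : W₀.leadingLCoeff ≠ 0 := W₀.leadingLCoeff_ne_zero_holds (hmod W₀)
  exact X12.missingUpperBoundAt_of_isIsogenous hCassels hiso hfin₀ hlead₀ hup₀

/-! ### §3 The same over the residual `WildRankOne` as typed (both halves) — for glue closers keyed on the route decl -/

/-- **The BODY of the K9 U₀-ns node `WildUpperNonsurjTower` (item 19189) WITHOUT L₀, over the residual as typed** — §2's theorem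
with `hRlow` fed by the first projection of the body of `WildRankOne` (item 19200: `MissingPPartAt` = both halves at the rank-one O6
rows). = p564462 `WildUpperOptimalSharpNodesJ08S2b.wildUpperNonsurjTower_of_jetchev08TwoSplit_of_boundAtPTwoSplit_of_cruxAResidue` with the
single binder `h₂` (the L₀ body) REMOVED, binder order otherwise unchanged; so any glue `… → WildLowerHalfRankZero → WildRankOne → …
→ WildUpperNonsurjTower` re-closes with L₀ dropped from its list. Conditional; nothing asserted; NO item is closed.
[cite: Manin1972, Cor. 3.6] [cite: Jetchev2008, Cor. 1.5 (p. 3)] [cite: Kato2004Asterisque, Thm. 14.5 (3) (p. 236)]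
[cite: MilneADT2006, Thm. I.7.3] -/
theorem wildUpperNonsurjTower_of_jetchev08TwoSplit_of_cruxAResidue_of_maninDrinfeld
    (hJ : ∀ (N : ℕ) [NeZero N] (W : WeierstrassCurve ℚ) [W.IsElliptic] [W.IsGloballyMinimal]
      (K : Type) [Field K] [NumberField K],
      IsImaginaryQuadratic K → NumberField.discr K ≠ -3 → NumberField.discr K ≠ -4 →
      SatisfiesHeegnerHypothesis N K → SatisfiesHeegnerHypothesis 2 K →
      ∀ (p : ℕ) [Fact p.Prime], p ≠ 2 → W.analyticRank = 0 → Addv W p → 0 ≤ padicValRat p W.j →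
      ¬ W.HasCM → W.HasIrreducibleModPGaloisRep p →
      ¬ (∀ n : ℕ, W.HasSurjectiveModNGaloisRep (p ^ n : ℕ)) →
      (∃ Dt : ModularParametrizationData W N,
        (∀ z ∈ Dt.L.lattice, ∃ w ∈ periodLattice Dt.f, z = (Dt.c : ℂ) * w) ∧ ¬ (p : ℤ) ∣ Dt.c) →
      ¬ p ∣ (W.baseChange ℚ_[p]).localTamagawaNumber ℤ_[p] →
      (∀ (q' : ℕ) [Fact q'.Prime], q' ∣ N →
        p ∣ (W.baseChange ℚ_[q']).localTamagawaNumber ℤ_[q'] → ¬ q' ^ 2 ∣ N) →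
      ∀ {P : (W.baseChange K).toAffine.Point}, IsHeegnerPoint N W K P → ¬ IsOfFinAddOrder P →
      ∀ (q : ℕ) [Fact q.Prime], q ∣ N → ¬ q ^ 2 ∣ N → q ≠ p →
      padicValNat p (Nat.card (AddCommGroup.primaryComponent (W.baseChange K).sha p)) +
          2 * padicValNat p ((W.baseChange ℚ_[q]).localTamagawaNumber ℤ_[q]) ≤
        2 * padicValNat p (AddSubgroup.zmultiples P).index)
    (hJp : ∀ (N : ℕ) [NeZero N] (W : WeierstrassCurve ℚ) [W.IsElliptic] [W.IsGloballyMinimal]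
      (K : Type) [Field K] [NumberField K],
      IsImaginaryQuadratic K → NumberField.discr K ≠ -3 → SatisfiesHeegnerHypothesis N K →
      SatisfiesHeegnerHypothesis 2 K →
      ∀ (p : ℕ) [Fact p.Prime], p ≠ 2 → W.analyticRank = 0 → Addv W p → 0 ≤ padicValRat p W.j →
      ¬ W.HasCM → W.HasIrreducibleModPGaloisRep p → ¬ (∀ n : ℕ, W.HasSurjectiveModNGaloisRep (p ^ n : ℕ)) →
      (∃ Dt : ModularParametrizationData W N,
        (∀ z ∈ Dt.L.lattice, ∃ w ∈ periodLattice Dt.f, z = (Dt.c : ℂ) * w) ∧ ¬ (p : ℤ) ∣ Dt.c) →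
      ∀ {P : (W.baseChange K).toAffine.Point}, IsHeegnerPoint N W K P → ¬ IsOfFinAddOrder P →
      p ∣ N →
      padicValNat p (Nat.card (AddCommGroup.primaryComponent (W.baseChange K).sha p)) +
          2 * padicValNat p ((W.baseChange ℚ_[p]).localTamagawaNumber ℤ_[p]) ≤
        2 * padicValNat p (AddSubgroup.zmultiples P).index)
    (hGZ : ∀ (N : ℕ) [NeZero N] (W : WeierstrassCurve ℚ) (K : Type) [Field K] [NumberField K],
      gross_zagier N W K)
    (hKo : ∀ (N : ℕ) [NeZero N] (W : WeierstrassCurve ℚ) (K : Type) [Field K] [NumberField K],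
      kolyvagin N W K)
    (hMN : ∀ (N : ℕ) [NeZero N] (W : WeierstrassCurve ℚ) (K : Type) [Field K] [NumberField K],
      MatarNekovar2019.thm03_padicValNat_card_sha_le_of_irreducible N W K)
    (hnf : exists_isNewformOf) (hBFH : bumpFriedbergHoffstein_exists_heegnerField_split_twist_simpleZero)
    (hCassels : bsdRHS_eq_of_isIsogenous)
    (hCS : ∀ (W : WeierstrassCurve ℚ) [W.IsElliptic] [W.IsGloballyMinimal] [Fact (3 : ℕ).Prime],
      W.analyticRank = 0 → ClassO6 W 3 → W.HasIrreducibleModPGaloisRep 3 →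
      ¬ (∀ n : ℕ, W.HasSurjectiveModNGaloisRep (3 ^ n : ℕ)) → ¬ W.HasCM →
      (∃ (W₀ : WeierstrassCurve ℚ) (_ : W₀.IsElliptic) (_ : W₀.IsGloballyMinimal)
          (_ : NeZero (W₀.conductorNorm ℤ)) (D₀ : ModularParametrizationData W₀ (W₀.conductorNorm ℤ)),
        IsIsogenous W W₀ ∧ (∀ z ∈ D₀.L.lattice, ∃ w ∈ periodLattice D₀.f, z = (D₀.c : ℂ) * w) ∧
        ((3 : ℤ) ∣ D₀.c ∨ (3 ∣ W₀.tamagawaProduct ∧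
          ¬ ∃ (q : ℕ) (_ : Fact q.Prime), q ∣ W₀.conductorNorm ℤ ∧
            (q ≠ 3 → ¬ q ^ 2 ∣ W₀.conductorNorm ℤ ∧ ¬ 3 ∣ (W₀.baseChange ℚ_[3]).localTamagawaNumber ℤ_[3]) ∧
            padicValNat 3 W₀.tamagawaProduct ≤
              padicValNat 3 ((W₀.baseChange ℚ_[q]).localTamagawaNumber ℤ_[q])))) →
      ∀ (κ : ZpExtension ℚ 3), κ.IsCyclotomic →
        ∃ (γ : Field.absoluteGaloisGroup ℚ) (Df : W.FineSelmerDualData κ γ),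
          Module.Finite ℤ_[3] (RestrictScalars ℤ_[3] (IwasawaAlgebra 3) Df.X))
    (hR : ∀ (W : WeierstrassCurve ℚ) [W.IsElliptic] [W.IsGloballyMinimal] [Fact (3 : ℕ).Prime],
      W.analyticRank = 1 → ClassO6 W 3 → MissingPPartAt W 3)
    (hK : Kato2004.rankZero_padicValNat_sha_add_padicValNat_tamagawa_le_of_additive_potGood_of_imageContainsSL2 ∧
      rank_eq_analyticRank_of_analyticRank_le_one ∧ WeierstrassCurve.hasEntireLFunction_rat)
    (hF : Kato2004.rankZero_padicValNat_sha_add_padicValNat_tamagawa_le_of_additive_potGood_of_irreducible_of_fineSelmerDual_fg ∧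
      bsdTriple_of_hasCM_of_L_one_ne_zero) :
    ∀ (W : WeierstrassCurve ℚ) [W.IsElliptic] [W.IsGloballyMinimal] [Fact (3 : ℕ).Prime],
      W.analyticRank = 0 → ClassO6 W 3 → W.HasIrreducibleModPGaloisRep 3 →
      ¬ (∀ n : ℕ, W.HasSurjectiveModNGaloisRep (3 ^ n : ℕ)) → MissingUpperBoundAt W 3 :=
  wildUpperNonsurjTower_of_jetchev08TwoSplit_of_cruxAResidue_of_rankOneLower_of_maninDrinfeld hJ hJp hGZ hKo hMN hnf hBFH
    hCassels hCS (fun W _ _ _ hr hO ↦ (lower_and_upper_of_missingPPartAt W 3 (hR W hr hO)).1) hK hF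

end Summit.BirchSwinnertonDyer.BirchSwinnertonDyer.Theorems.WildUpperOptimalSharpNodesJ08S2bMD

end
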